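import Summits.HodgeConjecture.CorCM.GaloisOddPartStructure
import HarnessLib

/-!
# THE ODD PART OF A GOOD GALOIS CM FIELD — the size condition restricted to ODD primes (supersedes `CorCM/GaloisOddPartStructure`,
# whose hypothesis `hsize` quantified over `p = 2` as well and thereby silently demanded `M ≥ 16`)

COR-CM (cell `pub-hodgecm2`), binder seat b04 (gen 38), count-neutral own lane «Galois-CM-type classification».  KERNEL ONLY:
theorems; no definition, no named fact, no `sorry`.  `HC_CM` is neither used nor claimed.

Same statements and proofs as `odd_part_eq_one_or_prime`, `exists_normal_odd_hall`, `struct_two_part` of `CorCM/GaloisOddPartStructure`,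
with the size hypothesis asked only for ODD primes `p < 31` dividing the degree (`p ≠ 2` added to `hsize`): for `[K:ℚ] = 2ⁿ·M`, `M` odd,
`n ≥ 4`, `K` GOOD ⟹ `M = 1` or `M` prime (`odd_part_eq_one_or_prime'`), a normal cyclic `P ≅ C_M` of index `2ⁿ` (`exists_normal_odd_hall'`),
and for `n ≥ 5` the STRUCT decomposition of `Gal(K^P/ℚ)` (`struct_two_part'`).  The proofs only ever invoke the size condition at odd
primes, so nothing else changes.  With `64 ∣ [K:ℚ]` the condition is automatic (`CorCM/GaloisLargeDegreeStructure`).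

## References

* [Shimura1998] G. Shimura, *Abelian Varieties with Complex Multiplication and Modular Functions*, §6.2 Thm. 3, §8.2 Prop. 26, §32.10.
* [Dodson1984] B. Dodson, *The structure of Galois groups of CM-fields*, Trans. AMS 283 (1984), §3.1.1, §4.1, §5.
* [Rotman1995] J. J. Rotman, *An Introduction to the Theory of Groups*, 4th ed., GTM 148, Thm. 4.12, Thm. 5.46, Thm. 7.41.
-/

noncomputable section

open CategoryTheory CategoryTheory.Limits NumberField
open scoped BigOperators

namespace Summit.HodgeConjecture.CorCM.GaloisModels

open Literature.NumberTheory.ComplexMultiplication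
open Literature.AlgebraicGeometry.Motives (AbelianVariety CMType)
open Literature.AlgebraicGeometry.HodgeTheory
open Literature.AlgebraicGeometry.ComplexMultiplication (IsCMTypeRealisation)
open Literature.AlgebraicGeometry.Pohlmann1968
open Summit.HodgeConjecture.CorCM.GaloisRank

variable {K : Type} [Field K] [NumberField K] [IsCMField K] [IsGalois ℚ K]

/-- **THE ODD PART OF THE DEGREE OF A GOOD GALOIS CM FIELD IS `1` OR A PRIME** (size condition at ODD primes `< 31` only).  `[K:ℚ] = 2ⁿ·M` with `M` odd and `n ≥ 4`; every prime
`p < 31` dividing `M` satisfies gen 33's size condition (for `[K:ℚ] = 2·pᵃ·m`, `p ∤ m`, `a ≥ 1`: `16 ≤ m`, and `8p ≤ 2^(m/4)` unless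
`p = 3`); `K` GOOD ⟹ `M = 1` or `M` is prime. [cite: Shimura1998, §8.2 Prop. 26 and §32.10] [cite: Dodson1984, §3.1.1, §4.1 and §5]
[cite: Rotman1995, Thm. 4.12 and Thm. 7.41] -/
theorem odd_part_eq_one_or_prime' {n M : ℕ} (hdeg : Module.finrank ℚ K = 2 ^ n * M) (hM : Odd M) (hn : 4 ≤ n)
    (hsize : ∀ p a m : ℕ, p.Prime → p ≠ 2 → p < 31 → Module.finrank ℚ K = 2 * p ^ a * m → ¬ p ∣ m → 1 ≤ a →
      16 ≤ m ∧ (p = 3 ∨ 8 * p ≤ 2 ^ (m / 4)))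
    (hgood : ∀ (Φ : CMType K) (φ : K →+* ℂ), IsPrimitive (ℂ ≃+* ℂ) Φ.1 φ → IsNondegenerate Φ) : M = 1 ∨ M.Prime := by
  classical
  by_cases hM1 : M = 1
  · exact Or.inl hM1
  right
  -- the least prime factor `p` of `M`
  set p := M.minFac with hp_def
  have hpp : p.Prime := Nat.minFac_prime hM1
  haveI : Fact p.Prime := ⟨hpp⟩
  have hpM : p ∣ M := Nat.minFac_dvd M
  have hp2 : p ≠ 2 := by
    rintro h
    rw [h] at hpM
    exact (Nat.not_even_iff_odd.2 hM) (even_iff_two_dvd.2 hpM)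
  obtain ⟨a, M₁, hMa, ha, hpM₁, hM₁⟩ := exists_eq_pow_mul_of_dvd hM hpp hpM
  obtain ⟨n', rfl⟩ := Nat.exists_eq_add_of_le hn
  have h2pow : (2 : ℕ) ^ (4 + n') = 2 * (8 * 2 ^ n') := by rw [pow_add]; ring
  -- `a = 1`
  have hdegp : Module.finrank ℚ K = 2 * p ^ a * (8 * 2 ^ n' * M₁) := by rw [hdeg, hMa, h2pow]; ring
  have hpm : ¬ p ∣ 8 * 2 ^ n' * M₁ := fun h => by
    rcases (Nat.Prime.dvd_mul hpp).1 h with h | h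
    · have : p ∣ 2 ^ (3 + n') := by rw [pow_add]; exact h
      exact hp2 ((Nat.prime_dvd_prime_iff_eq hpp Nat.prime_two).1 (hpp.dvd_of_dvd_pow this))
    · exact hpM₁ h
  have hm8 : 8 ≤ 8 * 2 ^ n' * M₁ := by
    have : 0 < 2 ^ n' * M₁ := Nat.mul_pos (pow_pos two_pos _) (Nat.pos_of_ne_zero (by rintro rfl; exact absurd hM₁ (by decide)))
    nlinarith
  obtain ⟨hPn, ha1⟩ := sylow_normal_and_le_one hp2 hdegp hpm hm8
    (fun h31 ha' => hsize p a _ hpp hp2 h31 hdegp hpm ha') hgood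
  have ha' : a = 1 := le_antisymm ha1 ha
  subst ha'
  rw [pow_one] at hMa
  -- no second prime factor
  by_contra hMp
  have hM₁1 : M₁ ≠ 1 := by
    rintro rfl
    rw [mul_one] at hMa
    exact hMp (hMa ▸ hpp)
  set q := M₁.minFac with hq_def
  have hqq : q.Prime := Nat.minFac_prime hM₁1
  haveI : Fact q.Prime := ⟨hqq⟩
  have hqM₁ : q ∣ M₁ := Nat.minFac_dvd M₁
  have hq2 : q ≠ 2 := by
    rintro h
    rw [h] at hqM₁
    exact (Nat.not_even_iff_odd.2 hM₁) (even_iff_two_dvd.2 hqM₁)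
  have hpq : p ≠ q := fun h => hpM₁ (h ▸ hqM₁)
  obtain ⟨b, M₂, hMb, hb, hqM₂, hM₂⟩ := exists_eq_pow_mul_of_dvd hM₁ hqq hqM₁
  have hpM₂ : ¬ p ∣ M₂ := fun h => hpM₁ (hMb ▸ h.mul_left _)
  -- the Sylow `q`-subgroups are normal too
  have hdegq : Module.finrank ℚ K = 2 * q ^ b * (8 * 2 ^ n' * (p * M₂)) := by rw [hdeg, hMa, hMb, h2pow]; ring
  have hqm : ¬ q ∣ 8 * 2 ^ n' * (p * M₂) := fun h => by
    rcases (Nat.Prime.dvd_mul hqq).1 h with h | h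
    · have : q ∣ 2 ^ (3 + n') := by rw [pow_add]; exact h
      exact hq2 ((Nat.prime_dvd_prime_iff_eq hqq Nat.prime_two).1 (hqq.dvd_of_dvd_pow this))
    · rcases (Nat.Prime.dvd_mul hqq).1 h with h | h
      · exact hpq ((Nat.prime_dvd_prime_iff_eq hqq hpp).1 h).symm
      · exact hqM₂ h
  have hM₂0 : 0 < M₂ := Nat.pos_of_ne_zero (by rintro rfl; exact absurd hM₂ (by decide))
  have hm8' : 8 ≤ 8 * 2 ^ n' * (p * M₂) := by
    have : 0 < 2 ^ n' * (p * M₂) := Nat.mul_pos (pow_pos two_pos _) (Nat.mul_pos hpp.pos hM₂0)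
    nlinarith
  obtain ⟨hQn, -⟩ := sylow_normal_and_le_one hq2 hdegq hqm hm8'
    (fun h31 hb' => hsize q b _ hqq hq2 h31 hdegq hqm hb') hgood
  -- two non-trivial normal Sylow subgroups of index `2ⁿ M₂ ≥ 16`: BAD
  have hdeg2 : Module.finrank ℚ K = p ^ 1 * q ^ b * (2 ^ (4 + n') * M₂) := by rw [hdeg, hMa, hMb]; ring
  have hpr : ¬ p ∣ 2 ^ (4 + n') * M₂ := fun h => by
    rcases (Nat.Prime.dvd_mul hpp).1 h with h | h
    · exact hp2 ((Nat.prime_dvd_prime_iff_eq hpp Nat.prime_two).1 (hpp.dvd_of_dvd_pow h))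
    · exact hpM₂ h
  have hqr : ¬ q ∣ 2 ^ (4 + n') * M₂ := fun h => by
    rcases (Nat.Prime.dvd_mul hqq).1 h with h | h
    · exact hq2 ((Nat.prime_dvd_prime_iff_eq hqq Nat.prime_two).1 (hqq.dvd_of_dvd_pow h))
    · exact hqM₂ h
  have h14 : 14 ≤ 2 ^ (4 + n') * M₂ := by
    have : 16 ≤ 2 ^ (4 + n') := by rw [pow_add]; have := Nat.one_le_two_pow (n := n'); nlinarith
    nlinarith
  obtain ⟨Φ, φ, X, ι, ϑ, H1, H2, -⟩ :=
    exists_simple_degenerate_of_two_primes_of_sylow_normal hp2 hq2 hpq hdeg2 hpr hqr le_rfl hb h14 hPn hQn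
  exact H2 (hgood Φ φ H1)

/-! ## §3 The structure: `Gal(K/ℚ) = C_M ⋊ P₂`, and the `2`-part -/

/-- **`Gal(K/ℚ) = C_M ⋊ P₂`.**  Under the hypotheses of `odd_part_eq_one_or_prime'`: there is a NORMAL CYCLIC subgroup `P ◁ Gal(K/ℚ)` of
order `M` (`M = 1` or prime) and index `2ⁿ`, not containing complex conjugation — the fixed field `K^P` is a Galois CM field of degree
`2ⁿ` and `Gal(K/ℚ)` is the semidirect product of `P ≅ C_M` by the `2`-group `Gal(K^P/ℚ)` (Schur–Zassenhaus).
[cite: Shimura1998, §8.2 Prop. 26 and §32.10] [cite: Dodson1984, §3.1.1, §4.1 and §5] [cite: Rotman1995, Thm. 4.12 and Thm. 7.41] -/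
theorem exists_normal_odd_hall' {n M : ℕ} (hdeg : Module.finrank ℚ K = 2 ^ n * M) (hM : Odd M) (hn : 4 ≤ n)
    (hsize : ∀ p a m : ℕ, p.Prime → p ≠ 2 → p < 31 → Module.finrank ℚ K = 2 * p ^ a * m → ¬ p ∣ m → 1 ≤ a →
      16 ≤ m ∧ (p = 3 ∨ 8 * p ≤ 2 ^ (m / 4)))
    (hgood : ∀ (Φ : CMType K) (φ : K →+* ℂ), IsPrimitive (ℂ ≃+* ℂ) Φ.1 φ → IsNondegenerate Φ) :
    ∃ P : Subgroup (K ≃ₐ[ℚ] K), P.Normal ∧ Nat.card P = M ∧ IsCyclic P ∧ P.index = 2 ^ n ∧ (M = 1 ∨ M.Prime) ∧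
      (IsCMField.complexConj K).restrictScalars ℚ ∉ P := by
  classical
  have hcP : ∀ P : Subgroup (K ≃ₐ[ℚ] K), Nat.card P = M → (IsCMField.complexConj K).restrictScalars ℚ ∉ P := by
    intro P hP hc
    have hcc := model_complexConj_mul_self (K := K) (MulEquiv.refl _) rfl
    have hc1 := model_complexConj_ne_one (K := K) (MulEquiv.refl _) rfl
    rw [MulEquiv.refl_apply] at hcc hc1
    have h2 : orderOf ((IsCMField.complexConj K).restrictScalars ℚ) = 2 := orderOf_eq_prime (by rw [pow_two]; exact hcc) hc1
    have hd : 2 ∣ Nat.card P := by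
      rw [← h2, ← Subgroup.orderOf_mk _ hc]
      exact orderOf_dvd_natCard _
    rw [hP] at hd
    exact (Nat.not_even_iff_odd.2 hM) (even_iff_two_dvd.2 hd)
  rcases odd_part_eq_one_or_prime' hdeg hM hn hsize hgood with hM1 | hMp
  · subst hM1
    refine ⟨⊥, inferInstance, Subgroup.card_bot, inferInstance, ?_, Or.inl rfl, hcP ⊥ Subgroup.card_bot⟩
    rw [Subgroup.index_bot, IsGalois.card_aut_eq_finrank, hdeg, mul_one]
  · haveI : Fact M.Prime := ⟨hMp⟩
    have hM2 : M ≠ 2 := by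
      rintro rfl
      exact absurd hM (by decide)
    obtain ⟨n', rfl⟩ := Nat.exists_eq_add_of_le hn
    have hdegM : Module.finrank ℚ K = 2 * M ^ 1 * (8 * 2 ^ n') := by rw [hdeg, pow_add]; ring
    have hMm : ¬ M ∣ 8 * 2 ^ n' := fun h => by
      have : M ∣ 2 ^ (3 + n') := by rw [pow_add]; exact h
      exact hM2 ((Nat.prime_dvd_prime_iff_eq hMp Nat.prime_two).1 (hMp.dvd_of_dvd_pow this))
    obtain ⟨hPn, -⟩ := sylow_normal_and_le_one hM2 hdegM hMm (by have := Nat.one_le_two_pow (n := n'); omega)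
      (fun h31 _ => hsize M 1 _ hMp hM2 h31 hdegM hMm le_rfl) hgood
    obtain ⟨P⟩ := (inferInstance : Nonempty (Sylow M (K ≃ₐ[ℚ] K)))
    haveI := hPn P
    obtain ⟨hcard, hidx⟩ := card_sylow_eq_of_finrank
      (by rw [hdeg, pow_one] ; ring : Module.finrank ℚ K = M ^ 1 * 2 ^ (4 + n')) (fun h =>
        hM2 ((Nat.prime_dvd_prime_iff_eq hMp Nat.prime_two).1 (hMp.dvd_of_dvd_pow h))) P
    rw [pow_one] at hcard
    haveI : Fact (Nat.card (P : Subgroup (K ≃ₐ[ℚ] K))).Prime := ⟨by rw [hcard]; exact hMp⟩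
    exact ⟨P, hPn P, hcard, isCyclic_of_prime_card (p := Nat.card (P : Subgroup (K ≃ₐ[ℚ] K))) rfl, hidx, Or.inr hMp,
      hcP _ hcard⟩

/-- **THE `2`-PART: `Gal(K^P/ℚ) ∈ {C, Q, C × C₂, Q × C₂}`.**  Under the hypotheses of `odd_part_eq_one_or_prime'` with `n ≥ 5`: for the
normal cyclic subgroup `P ≅ C_M` of `exists_normal_odd_hall'`, the fixed field `K^P` is a GOOD Galois CM field of degree `2ⁿ`, so (gen 37
`struct_two_power`) `Gal(K^P/ℚ) = H·E` with `E` central of exponent `2`, `|E| ≤ 2`, complex conjugation in `H ∖ E`, and `H` cyclic or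
generalised quaternion. [cite: Shimura1998, §8.2 Prop. 26 and §32.10] [cite: Rotman1995, Thm. 5.46 and Thm. 7.41] [cite: Dodson1984, §5] -/
theorem struct_two_part' {n M : ℕ} (hdeg : Module.finrank ℚ K = 2 ^ n * M) (hM : Odd M) (hn : 5 ≤ n)
    (hsize : ∀ p a m : ℕ, p.Prime → p ≠ 2 → p < 31 → Module.finrank ℚ K = 2 * p ^ a * m → ¬ p ∣ m → 1 ≤ a →
      16 ≤ m ∧ (p = 3 ∨ 8 * p ≤ 2 ^ (m / 4)))
    (hgood : ∀ (Φ : CMType K) (φ : K →+* ℂ), IsPrimitive (ℂ ≃+* ℂ) Φ.1 φ → IsNondegenerate Φ) :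
    ∃ P : Subgroup (K ≃ₐ[ℚ] K), ∃ _ : P.Normal, Nat.card P = M ∧ IsCyclic P ∧ P.index = 2 ^ n ∧ (M = 1 ∨ M.Prime) ∧
      ∃ _ : IsCMField (IntermediateField.fixedField P), ∃ _ : IsGalois ℚ (IntermediateField.fixedField P),
        Module.finrank ℚ (IntermediateField.fixedField P) = 2 ^ n ∧
        (∀ (Φ : CMType (IntermediateField.fixedField P)) (φ : IntermediateField.fixedField P →+* ℂ),
          IsPrimitive (ℂ ≃+* ℂ) Φ.1 φ → IsNondegenerate Φ) ∧
        ∃ (H E : Subgroup (IntermediateField.fixedField P ≃ₐ[ℚ] IntermediateField.fixedField P)) (k : ℕ),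
          H.IsComplement' E ∧
          (IsCMField.complexConj (IntermediateField.fixedField P)).restrictScalars ℚ ∈ H ∧
          (IsCMField.complexConj (IntermediateField.fixedField P)).restrictScalars ℚ ∉ E ∧
          (∀ e ∈ E, e * e = 1 ∧ ∀ g : IntermediateField.fixedField P ≃ₐ[ℚ] IntermediateField.fixedField P, g * e = e * g) ∧
          Nat.card E ≤ 2 ∧ Nat.card H = 2 ^ k ∧ (IsCyclic H ∨ (3 ≤ k ∧ Nonempty (H ≃* QuaternionGroup (2 ^ (k - 2))))) := by
  classical
  obtain ⟨P, hPn, hcard, hcyc, hidx, hM1, hcP⟩ := exists_normal_odd_hall' hdeg hM (by omega) hsize hgood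
  haveI := hPn
  haveI hCM : IsCMField (IntermediateField.fixedField P) := isCMField_fixedField_of_not_mem P hcP
  haveI hGal : IsGalois ℚ (IntermediateField.fixedField P) := IsGalois.of_fixedField_normal_subgroup P
  have hdegP : Module.finrank ℚ (IntermediateField.fixedField P) = 2 ^ n := by rw [finrank_fixedField_eq_index P, hidx]
  -- `K^P` is GOOD: either `P = 1` (then `K^P ≅ K`… handled by degree: GOOD descends needs `P ≠ 1`) or GOOD descends along `K ⊇ K^P`
  have hgoodP : ∀ (Φ : CMType (IntermediateField.fixedField P)) (φ : IntermediateField.fixedField P →+* ℂ),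
      IsPrimitive (ℂ ≃+* ℂ) Φ.1 φ → IsNondegenerate Φ := by
    by_cases hP1 : P = ⊥
    · -- `P = 1`: `K^P = K^1 = K` up to the isomorphism `topEquiv`
      subst hP1
      exact forall_isNondegenerate_of_isPrimitive_of_ringEquiv
        ((IntermediateField.equivOfEq (IntermediateField.fixedField_bot (F := ℚ) (E := K))).trans
          IntermediateField.topEquiv).symm.toRingEquiv hgood
    · exact isNondegenerate_of_isPrimitive_of_fixedField_of_ne_bot P hcP hP1 hgood
  obtain ⟨H, E, k, h1, h2, h3, h4, h5, h6, h7⟩ := struct_two_power hdegP hn hgoodP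
  exact ⟨P, hPn, hcard, hcyc, hidx, hM1, hCM, hGal, hdegP, hgoodP, H, E, k, h1, h2, h3, h4, h5, h6, h7⟩

end Summit.HodgeConjecture.CorCM.GaloisModels

end
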